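import Summits.AtomisticToContinuum.Crystallization.Theorems.FreeSplittingCertificatesStrictSplittingRuleP1SiteLedger

/-!
# `StrictSplittingRule` (stmt-AtomisticToContinuum-12560): THE FINITE NEAR-LEDGER FORM — the kernel statement of the near certificate (G9 of the assembly map; P1 interpolant object, part 58)

Route `FreeSplittingCertificates`, crux r3 `StrictSplittingRule` (H12⋆ = `stub_coreJointCoercive`), unit b2b-freesplit-B gen 33.
VALUE = DEFINITIONS.  The near-ledger inequality `hNear` of `coreJointSiteIneq_of_ledgers` (part 56) / `coreJointCoercive_of_ledgers` (part 57)
is an inequality between INFINITE series of the displacement `u`.  The near certificate of the cell (HOME CERT §30 (3), "v9") is a FINITE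
quadratic form.  This file writes that finite form in the tree's vocabulary, as a function of LATTICE VALUES `V : ℤ³ → ℝ³` (the far-ledger
field `V q = u_q − u_p − W(y_q − y_p)`, `V p = 0`), over EXPLICIT finite index sets and tables — exactly the term groups of `nearcert.py`:
* `p1NRead V q s = |V(q+s) − V q|²` (bond readout), `p1NStr a h V q s = ⟪y_{q+s} − y_q, V(q+s) − V q⟫` (stretch), `p1NRad a h p V q = ⟪y_q − y_p, V q⟫`;
* `p1NearBare` — the lattice pair form at the sites of a finite REACH SET `QB` with the matched far shares removed through the TABLES `(L, U)`
  (`+ L q·⟪d_q,V_q⟫²`: far covers at least that much of the radial deficit; `− U q·|V_q|²`: far consumes at most that much of the tangential credit);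
* `p1NearTransfer` — the antisymmetrised near-table transfers (tables `M₁, N`, verbatim summand of `CoreJointSiteIneq`) over a finite site set `QT`;
* `p1NearShell` — `κ₁Σ_shell⟪d_q,V_q⟫² + κ₃Σ_shell|V_q|²` over the explicit first shell `SH`;
* `p1NearRead` — the readout-form legs the near side keeps: `Σ_{(q,s) ∈ LEG} ([q≠p][s∈Y₁]½β(b_q)(p−q)(s) − w(q,s) − [s = s_v]·wv q)·|V(q+s) − V q|²` minus the
  local column-sum term `½Σ_{s∈Y₁} colβ_s·|V(p+s) − V p|²` (`colβ_s = Σ'_{q≠p} β(b_p)(q−p)(s)`; `= −β(b_p)(0)(s)` for the line truss by zero total tension);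
* `p1NearPay` — the far table's payments `Σ_s PAYM_s·g_V(p,s)²` (column-sum enclosures of `κ(2/5)a⁻⁴·p1RecTable`);
* `p1NearFlux` — the flux enclosure `Σ_{q,q'∈QF} V_qᵀ F₀[q,q'] V_{q'} + Σ_{q∈QF} Δ_q|V_q|²` (CERT §30 (1));
* `p1NearForm = Bare + Transfer − Shell − Read − Pay − κ·Flux` (the column-sum term sits inside `Read`).  The near certificate asserts `0 ≤ p1NearForm … V`
  on the LEAST-SQUARES CONSTRAINT SET: `V p = 0` and the first-shell moment condition `Σ_{q∈SH}⟪V_q, Z(y_q − y_p)⟫ = 0` for every antisymmetric `Z`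
  (the normal equations of `W_LS`; stated inline in part 59, no `Prop` definition).
Plus two bookkeeping lemmas on the hat-averaged far shares: `p1SiteBare` at `q` depends on `V q` only (`p1SiteBare_congr_apply`) and vanishes when `V q = 0`.
The companion part 59 proves `hNear` from `0 ≤ p1NearForm` on the constraint set + per-site domination (S) off `QB` + the tables on `QB` + the payment and
flux enclosures.  NOT a proof of H12⋆, NOT summit progress.  [folklore]
-/

noncomputable section

open Set Function Metric MeasureTheory Filter Topology
open scoped BigOperators NNReal ENNReal Classical

namespace Summit.AtomisticToContinuum.Crystallization.Theorems.StrictSplittingRuleBirth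

open Literature.MathematicalPhysics.StatisticalMechanics
open Summit.AtomisticToContinuum.Crystallization.Theorems.PalmUnimodularRigidity.LayeredLawsSelectHcp

/-! ## Readouts, stretches, radial components of lattice values -/

/-- Bond readout of lattice values: `|V(q+s) − V q|²`. [folklore] -/
def p1NRead (V : ℤ × ℤ × ℤ → (Fin 3 → ℝ)) (q s : ℤ × ℤ × ℤ) : ℝ :=
  fpSq (fun k => V (q + s) k - V q k)

/-- Stretch of lattice values along the bond `q → q + s`: `⟪y_{q+s} − y_q, V(q+s) − V q⟫`. [folklore] -/
def p1NStr (a h : ℝ) (V : ℤ × ℤ × ℤ → (Fin 3 → ℝ)) (q s : ℤ × ℤ × ℤ) : ℝ :=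
  ∑ k : Fin 3, (hcpSite a h (q + s) k - hcpSite a h q k) * (V (q + s) k - V q k)

/-- Radial component of a lattice value seen from `p`: `⟪y_q − y_p, V q⟫`. [folklore] -/
def p1NRad (a h : ℝ) (p : ℤ × ℤ × ℤ) (V : ℤ × ℤ × ℤ → (Fin 3 → ℝ)) (q : ℤ × ℤ × ℤ) : ℝ :=
  ∑ k : Fin 3, (hcpSite a h q k - hcpSite a h p k) * V q k

/-- Readouts are nonnegative. -/
theorem p1NRead_nonneg (V : ℤ × ℤ × ℤ → (Fin 3 → ℝ)) (q s : ℤ × ℤ × ℤ) : 0 ≤ p1NRead V q s := fpSq_nonneg _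

/-! ## The term groups of the finite near form -/

/-- **NEAR BARE**: the lattice pair form over the reach set `QB` with the far shares removed through the tables `(L, U)`:
`Σ_{q∈QB} [q≠p]·(½(W′(s_q)|V_q|² + 2W″(s_q)⟪d_q,V_q⟫²) + L q·⟪d_q,V_q⟫² − U q·|V_q|²)`. [folklore] -/
def p1NearBare (a h : ℝ) (p : ℤ × ℤ × ℤ) (QB : Finset (ℤ × ℤ × ℤ)) (L U : (ℤ × ℤ × ℤ) → ℝ) (V : ℤ × ℤ × ℤ → (Fin 3 → ℝ)) : ℝ :=
  ∑ q ∈ QB, if q = p then (0 : ℝ) else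
    (1 / 2 * (ljSqDeriv (‖hcpSite a h q - hcpSite a h p‖ ^ 2) * fpSq (V q) +
        2 * (1 / 2 * (7 * ((‖hcpSite a h q - hcpSite a h p‖ ^ 2)⁻¹) ^ 8 -
          4 * ((‖hcpSite a h q - hcpSite a h p‖ ^ 2)⁻¹) ^ 5)) * p1NRad a h p V q ^ 2) +
      L q * p1NRad a h p V q ^ 2 - U q * fpSq (V q))

/-- **NEAR TRANSFERS**: the antisymmetrised transfers of the near tables `M₁, N` (verbatim summand of `CoreJointSiteIneq`, stretches of `V`) over `QT`. [folklore] -/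
def p1NearTransfer (a h : ℝ) (p : ℤ × ℤ × ℤ) (M₁ N : Bool → (ℤ × ℤ × ℤ) → (ℤ × ℤ × ℤ) → (ℤ × ℤ × ℤ) → ℝ) (QT : Finset (ℤ × ℤ × ℤ))
    (V : ℤ × ℤ × ℤ → (Fin 3 → ℝ)) : ℝ :=
  ∑ q ∈ QT, if q = p then (0 : ℝ) else
    ∑ s ∈ p1BondOffsets, ∑ s' ∈ p1BondOffsets,
      (M₁ (decide (Even p.1)) (q - p) s s' * (p1NStr a h V p s * p1NStr a h V p s') -
        M₁ (decide (Even q.1)) (p - q) s s' * (p1NStr a h V q s * p1NStr a h V q s') +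
        (N (decide (Even p.1)) (q - p) s s' - N (decide (Even q.1)) (p - q) s' s) * (p1NStr a h V p s * p1NStr a h V q s'))

/-- **SHELL DEMAND**: `κ₁Σ_{q∈SH}⟪d_q,V_q⟫² + κ₃Σ_{q∈SH}|V_q|²`. [folklore] -/
def p1NearShell (a h κ₁ κ₃ : ℝ) (p : ℤ × ℤ × ℤ) (SH : Finset (ℤ × ℤ × ℤ)) (V : ℤ × ℤ × ℤ → (Fin 3 → ℝ)) : ℝ :=
  κ₁ * (∑ q ∈ SH, p1NRad a h p V q ^ 2) + κ₃ * ∑ q ∈ SH, fpSq (V q)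

/-- **NEAR READOUT DEMAND**: the legs in `LEG` with the near-kept share `[q≠p][s∈Y₁]½β(b_q)(p−q)(s) − w(q,s) − [s = s_v]·wv q`, minus the local
column-sum term `½Σ_{s∈Y₁} colβ_s·|V(p+s) − V p|²`. [folklore] -/
def p1NearRead (p : ℤ × ℤ × ℤ) (Y₁ : Finset (ℤ × ℤ × ℤ)) (β : Bool → (ℤ × ℤ × ℤ) → (ℤ × ℤ × ℤ) → ℝ)
    (w : (ℤ × ℤ × ℤ) × (ℤ × ℤ × ℤ) → ℝ) (sv : ℤ × ℤ × ℤ) (wv : (ℤ × ℤ × ℤ) → ℝ) (colβ : (ℤ × ℤ × ℤ) → ℝ)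
    (LEG : Finset ((ℤ × ℤ × ℤ) × (ℤ × ℤ × ℤ))) (V : ℤ × ℤ × ℤ → (Fin 3 → ℝ)) : ℝ :=
  (∑ e ∈ LEG, ((if e.1 ≠ p ∧ e.2 ∈ Y₁ then 1 / 2 * β (decide (Even e.1.1)) (p - e.1) e.2 else 0) - w e -
      (if e.2 = sv then wv e.1 else 0)) * p1NRead V e.1 e.2) -
    ∑ s ∈ Y₁, 1 / 2 * colβ s * p1NRead V p s

/-- **FAR-TABLE PAYMENTS**: `Σ_{s ∈ p1BondOffsets} PAYM_s·g_V(p,s)²`. [folklore] -/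
def p1NearPay (a h : ℝ) (p : ℤ × ℤ × ℤ) (PAYM : (ℤ × ℤ × ℤ) → ℝ) (V : ℤ × ℤ × ℤ → (Fin 3 → ℝ)) : ℝ :=
  ∑ s ∈ p1BondOffsets, PAYM s * p1NStr a h V p s ^ 2

/-- **FLUX ENCLOSURE FORM**: `Σ_{q,q'∈QF}Σ_{k,l} F₀(q,k)(q',l)·V_q,k·V_{q'},l + Σ_{q∈QF} Δ_q·|V_q|²`. [folklore] -/
def p1NearFlux (FL0 : (ℤ × ℤ × ℤ) × Fin 3 → (ℤ × ℤ × ℤ) × Fin 3 → ℝ) (Δ : (ℤ × ℤ × ℤ) → ℝ) (QF : Finset (ℤ × ℤ × ℤ))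
    (V : ℤ × ℤ × ℤ → (Fin 3 → ℝ)) : ℝ :=
  (∑ q ∈ QF, ∑ q' ∈ QF, ∑ k : Fin 3, ∑ l : Fin 3, FL0 (q, k) (q', l) * (V q k * V q' l)) + ∑ q ∈ QF, Δ q * fpSq (V q)

/-- **THE FINITE NEAR-LEDGER FORM** `Bare + Transfer − Shell − Read − Pay − κ·Flux` (all data explicit and finite). [folklore] -/
def p1NearForm (a h κ₁ κ₃ κ : ℝ) (p : ℤ × ℤ × ℤ) (Y₁ : Finset (ℤ × ℤ × ℤ)) (β : Bool → (ℤ × ℤ × ℤ) → (ℤ × ℤ × ℤ) → ℝ)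
    (M₁ N : Bool → (ℤ × ℤ × ℤ) → (ℤ × ℤ × ℤ) → (ℤ × ℤ × ℤ) → ℝ)
    (w : (ℤ × ℤ × ℤ) × (ℤ × ℤ × ℤ) → ℝ) (sv : ℤ × ℤ × ℤ) (wv : (ℤ × ℤ × ℤ) → ℝ) (colβ : (ℤ × ℤ × ℤ) → ℝ)
    (SH QB QT QF : Finset (ℤ × ℤ × ℤ)) (LEG : Finset ((ℤ × ℤ × ℤ) × (ℤ × ℤ × ℤ)))
    (L U PAYM Δ : (ℤ × ℤ × ℤ) → ℝ) (FL0 : (ℤ × ℤ × ℤ) × Fin 3 → (ℤ × ℤ × ℤ) × Fin 3 → ℝ)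
    (V : ℤ × ℤ × ℤ → (Fin 3 → ℝ)) : ℝ :=
  p1NearBare a h p QB L U V + p1NearTransfer a h p M₁ N QT V - p1NearShell a h κ₁ κ₃ p SH V -
    p1NearRead p Y₁ β w sv wv colβ LEG V - p1NearPay a h p PAYM V - κ * p1NearFlux FL0 Δ QF V

/-! ## The hat-averaged far shares at a site depend on the value at that site only -/

/-- `p1SiteBare … V q` depends on `V q` only. -/
theorem p1SiteBare_congr_apply (a h : ℝ) (W : (Fin 3 → ℝ) → Fin 3 → Fin 3 → ℝ) (V : ℤ × ℤ × ℤ → (Fin 3 → ℝ)) (q : ℤ × ℤ × ℤ) :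
    p1SiteBare a h W V q = p1SiteBare a h W (fun _ => V q) q := by
  unfold p1SiteBare
  refine Finset.sum_congr rfl fun o _ => Finset.sum_congr rfl fun π _ => Finset.sum_congr rfl fun m _ => ?_
  split_ifs with hv
  · unfold p1CellBare p1CellVals
    dsimp only
    rw [hv, sub_add_cancel]
  · rfl

/-- `p1SiteBare … V q = 0` when `V q = 0`. -/
theorem p1SiteBare_eq_zero_of_apply (a h : ℝ) (W : (Fin 3 → ℝ) → Fin 3 → Fin 3 → ℝ) {V : ℤ × ℤ × ℤ → (Fin 3 → ℝ)} {q : ℤ × ℤ × ℤ}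
    (hq : V q = 0) : p1SiteBare a h W V q = 0 := by
  rw [p1SiteBare_congr_apply, hq]
  unfold p1SiteBare
  refine Finset.sum_eq_zero fun o _ => Finset.sum_eq_zero fun π _ => Finset.sum_eq_zero fun m _ => ?_
  split_ifs
  · unfold p1CellBare p1CellVals p1Quad3
    simp only [Pi.zero_apply, mul_zero, Finset.sum_const_zero, integral_zero]
  · rfl

/-- The pair form `½W′|z|² + 2W″⟪d,z⟫²`-type summand vanishes at `z = 0` (used at `q = p`). -/
theorem p1NRad_zero_of_apply (a h : ℝ) (p : ℤ × ℤ × ℤ) {V : ℤ × ℤ × ℤ → (Fin 3 → ℝ)} {q : ℤ × ℤ × ℤ} (hq : V q = 0) :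
    p1NRad a h p V q = 0 := by
  unfold p1NRad
  simp only [hq, Pi.zero_apply, mul_zero, Finset.sum_const_zero]

end Summit.AtomisticToContinuum.Crystallization.Theorems.StrictSplittingRuleBirth

end
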